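import Literature.Probability.RandomPlanarGeometry.SAWIrreducibleBridgeCrossings
import Literature.Probability.RandomPlanarGeometry.SAWPulledLargeForceExpansionZdFirstOrder
import HarnessLib

/-!
# Irreducible bridges of `ℤ^{d+1}` of span `A` and length `3A + 1`: the forced height words (one slack in the three-span count)

Topic `Literature/Probability/RandomPlanarGeometry` (continues `SAWIrreducibleBridgeThreeSpan.lean` — `3A ≤ k` — and the extremal
case `k = 3A` of `SAWIrreducibleBridgeThreeSpanExtremal.lean`, Madras–Slade §4.2, p. 94).

ONE SLACK. If `k = 3A + 1` (`A ≥ 2`) the three-span count leaves room for exactly one more non-crossing step: the walk has THREE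
transverse steps — the two turn plateaus of the staple `U^A T D^{A−1} T U^{A−1}` and a third one at a slot `σ` with `1 ≤ σ ≤ 3A`,
`σ ≠ A + 1`, `σ ≠ 2A` (two transverse steps cannot both fit: `#vertical ≡ A (mod 2)`; this parity is read off the run structure).
The height word is then `subH A σ`: the staple word `stapleHN A` with the letter at position `σ` doubled.
Ingredients: the crossing count of the three-span lemma (every internal gap is crossed thrice, gap `0` once), self-avoidance (no
`±e₀, ∓e₀` step pairs, so maximal vertical runs are monotone — inside the descent this needs the «next down-step» argument), and
irreducibility (the first plateau is at the top height `A`, else the final ascent passes that height at a renewal time).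

## Contents (namespace `Literature.Probability.RandomPlanarGeometry.SAW.Zd`)
`stapleHN`, `subH` (ℕ tables); ★★ `heights_of_length_eq_three_mul_span_add_one`. Lane «pcv-sawmu» (a-p3 g16, 2026-08-24).
[cite: MadrasSlade1993, §4.2, remark after Theorem 4.2.4 (p. 94)] [cite: DuminilCopinHammond2013, §2.2]
-/

noncomputable section

open Finset Literature.Probability.LatticeModels SimpleGraph
open scoped BigOperators
open Literature.Probability.RandomPlanarGeometry.SAW

namespace Literature.Probability.RandomPlanarGeometry.SAW.Zd

/-- Staple heights (ℕ-valued): `j` (`j ≤ A`), `2A+1−j` (`A < j ≤ 2A`), `j − 2A` (`2A < j ≤ 3A`), `A` beyond. [cite: MadrasSlade1993, §4.2, remark after Theorem 4.2.4 (p. 94)] -/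
def stapleHN (A j : ℕ) : ℕ := if j ≤ A then j else if j ≤ 2 * A then 2 * A + 1 - j else if j ≤ 3 * A then j - 2 * A else A

/-- Heights of the staple with the letter at slot `σ` doubled: `h'_i = h_i` (`i ≤ σ`), `h'_i = h_{i−1}` (`i > σ`). [cite: MadrasSlade1993, §4.2, remark after Theorem 4.2.4 (p. 94)] -/
def subH (A σ i : ℕ) : ℕ := stapleHN A (if i ≤ σ then i else i - 1)

/-- First up-crossing of the gap `{g, g+1}` after `t₀` (±1-Lipschitz integer sequence). [folklore] -/
private theorem upcrossSl {h : ℕ → ℤ} {k : ℕ} (hstep : ∀ t, t < k → |h (t + 1) - h t| ≤ 1)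
    {t₀ s₁ : ℕ} {g : ℤ} (h01 : t₀ ≤ s₁) (hs₁ : s₁ ≤ k) (hlo : h t₀ ≤ g) (hhi : g + 1 ≤ h s₁) :
    ∃ t, t₀ ≤ t ∧ t < s₁ ∧ h t = g ∧ h (t + 1) = g + 1 := by
  classical
  have hex : ∃ s, t₀ ≤ s ∧ s ≤ s₁ ∧ g + 1 ≤ h s := ⟨s₁, h01, le_rfl, hhi⟩
  obtain ⟨s, ⟨hs0, hss₁, hsg⟩, hmin⟩ : ∃ s, (t₀ ≤ s ∧ s ≤ s₁ ∧ g + 1 ≤ h s) ∧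
      ∀ u, u < s → ¬ (t₀ ≤ u ∧ u ≤ s₁ ∧ g + 1 ≤ h u) :=
    ⟨Nat.find hex, Nat.find_spec hex, fun u hu => Nat.find_min hex hu⟩
  have hst₀ : s ≠ t₀ := by rintro rfl; omega
  obtain ⟨t, rfl⟩ : ∃ t, s = t + 1 := ⟨s - 1, by omega⟩
  have ht : h t ≤ g := by
    have := hmin t (Nat.lt_succ_self t)
    simp only [not_and, not_le] at this
    have := this (by omega) (by omega)
    omega
  have hs := hstep t (by omega)
  rw [abs_le] at hs
  exact ⟨t, by omega, by omega, by omega, by omega⟩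

/-- First down-crossing of the gap `{g, g+1}` after `t₀` (±1-Lipschitz integer sequence). [folklore] -/
private theorem downcrossSl {h : ℕ → ℤ} {k : ℕ} (hstep : ∀ t, t < k → |h (t + 1) - h t| ≤ 1)
    {t₀ s₁ : ℕ} {g : ℤ} (h01 : t₀ ≤ s₁) (hs₁ : s₁ ≤ k) (hhi : g + 1 ≤ h t₀) (hlo : h s₁ ≤ g) :
    ∃ t, t₀ ≤ t ∧ t < s₁ ∧ h t = g + 1 ∧ h (t + 1) = g := by
  classical
  have hex : ∃ s, t₀ ≤ s ∧ s ≤ s₁ ∧ h s ≤ g := ⟨s₁, h01, le_rfl, hlo⟩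
  obtain ⟨s, ⟨hs0, hss₁, hsg⟩, hmin⟩ : ∃ s, (t₀ ≤ s ∧ s ≤ s₁ ∧ h s ≤ g) ∧
      ∀ u, u < s → ¬ (t₀ ≤ u ∧ u ≤ s₁ ∧ h u ≤ g) :=
    ⟨Nat.find hex, Nat.find_spec hex, fun u hu => Nat.find_min hex hu⟩
  have hst₀ : s ≠ t₀ := by rintro rfl; omega
  obtain ⟨t, rfl⟩ : ∃ t, s = t + 1 := ⟨s - 1, by omega⟩
  have ht : g + 1 ≤ h t := by
    have := hmin t (Nat.lt_succ_self t)
    simp only [not_and, not_le] at this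
    have := this (by omega) (by omega)
    omega
  have hs := hstep t (by omega)
  rw [abs_le] at hs
  exact ⟨t, by omega, by omega, by omega, by omega⟩

/-- The staple table over `ℤ`. [cite: MadrasSlade1993, §4.2, remark after Theorem 4.2.4 (p. 94)] -/
private theorem stapleHN_cast (A j : ℕ) : ((stapleHN A j : ℕ) : ℤ) =
    if j ≤ A then (j : ℤ) else if j ≤ 2 * A then 2 * A + 1 - j else if j ≤ 3 * A then (j : ℤ) - 2 * A else A := by
  simp only [stapleHN]; split_ifs <;> omega

/-- The staple table over `ℤ`, shifted by one. [cite: MadrasSlade1993, §4.2, remark after Theorem 4.2.4 (p. 94)] -/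
private theorem stapleHN_pred_cast (A t : ℕ) (h1 : 1 ≤ t) (ht : t ≤ 3 * A + 2) : ((stapleHN A (t - 1) : ℕ) : ℤ) =
    if t ≤ A + 1 then (t : ℤ) - 1 else if t ≤ 2 * A + 1 then 2 * A + 2 - t else if t ≤ 3 * A + 1 then (t : ℤ) - 1 - 2 * A else A := by
  simp only [stapleHN]; split_ifs <;> omega

/-- The arithmetic end of the one-slack theorem: from the three monotone runs (with the extra plateau at `τ₃`), the peak `A`,
the valley `1` and `k = 3A + 1`, the position of `τ₃` is pinned and the height word is `subH A τ₃`. [cite: MadrasSlade1993, §4.2, remark after Theorem 4.2.4 (p. 94)] -/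
private theorem slack_word {h : ℕ → ℤ} {A k τ₁ tm tM τ₃ : ℕ} (hA2 : 2 ≤ A) (hk : k = 3 * A + 1) (hτ₁ : tm = τ₁ + 1)
    (htmM : tm ≤ tM) (htMk : tM + 2 ≤ k) (hτ₃k : τ₃ < k) (hτ₃0 : 1 ≤ τ₃) (hτ₃tM : τ₃ ≠ tM)
    (hx : (τ₁ : ℤ) = A + if τ₃ < τ₁ then 1 else 0)
    (hy : ((tM + 1 - tm : ℕ) : ℤ) = A - 1 + if tm < τ₃ ∧ τ₃ < tM + 1 then 1 else 0)
    (hz : ((k - (tM + 1) - 1 : ℕ) : ℤ) = A - 1 + if tM + 1 < τ₃ ∧ τ₃ < k then 1 else 0)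
    (hrun1 : ∀ t, t ≤ τ₁ → h t = t - if τ₃ < t then 1 else 0)
    (hrun2' : ∀ j, tm + j ≤ tM + 1 → h (tm + j) = h tm - j + if tm < τ₃ ∧ τ₃ < tm + j then 1 else 0)
    (hrun3 : ∀ j, tM + 2 + j ≤ k → h (tM + 2 + j) = h (tM + 2) + j - if tM + 1 < τ₃ ∧ τ₃ < tM + 2 + j then 1 else 0)
    (hpk : h tm = A) (hv2 : h (tM + 2) = 1) :
    1 ≤ τ₃ ∧ τ₃ ≤ 3 * A ∧ τ₃ ≠ A + 1 ∧ τ₃ ≠ 2 * A ∧ ∀ t, t ≤ k → h t = subH A τ₃ t := by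
  -- the position of `τ₃`: before `τ₁`, strictly inside the descent, or after `tM + 1` (never absent: `k = 3A + 1`)
  have hc1 : ((tM + 1 - tm : ℕ) : ℤ) = (tM : ℤ) + 1 - tm := by push_cast [Nat.cast_sub (show tm ≤ tM + 1 by omega)]; ring
  have hc2 : ((k - (tM + 1) - 1 : ℕ) : ℤ) = (k : ℤ) - tM - 2 := by
    rw [Nat.sub_sub, Nat.cast_sub (show tM + 1 + 1 ≤ k by omega)]; push_cast; ring
  rw [hc1] at hy
  rw [hc2] at hz
  have hcase : (τ₃ < τ₁ ∧ τ₁ = A + 1 ∧ tM = 2 * A) ∨ (tm < τ₃ ∧ τ₃ < tM + 1 ∧ τ₁ = A ∧ tM = 2 * A) ∨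
      (tM + 1 < τ₃ ∧ τ₁ = A ∧ tM = 2 * A - 1) := by
    by_cases ha : τ₃ < τ₁
    · rw [if_pos ha] at hx; rw [if_neg (by omega)] at hy; rw [if_neg (by omega)] at hz
      left; omega
    rw [if_neg ha] at hx
    by_cases hb : tm < τ₃ ∧ τ₃ < tM + 1
    · rw [if_pos hb] at hy; rw [if_neg (by omega)] at hz
      right; left; omega
    rw [if_neg hb] at hy
    by_cases hc : tM + 1 < τ₃ ∧ τ₃ < k
    · rw [if_pos hc] at hz
      right; right; omega
    · rw [if_neg hc] at hz
      exfalso; omega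
  have hs1 : τ₃ ≤ 3 * A := by omega
  have hs2 : τ₃ ≠ A + 1 := by rcases hcase with ⟨hc1, hc2, hc3⟩ | ⟨hc1, hc2, hc3, hc4⟩ | ⟨hc1, hc2, hc3⟩ <;> omega
  have hs3 : τ₃ ≠ 2 * A := by rcases hcase with ⟨hc1, hc2, hc3⟩ | ⟨hc1, hc2, hc3, hc4⟩ | ⟨hc1, hc2, hc3⟩ <;> omega
  clear hx hy hz hc1 hc2
  refine ⟨hτ₃0, hs1, hs2, hs3, fun t ht => ?_⟩
  -- the height at `t` from the runs
  have H : h t = if t ≤ τ₁ then (t : ℤ) - (if τ₃ < t then 1 else 0)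
      else if t ≤ tM + 1 then (A : ℤ) - (t - tm) + (if tm < τ₃ ∧ τ₃ < t then 1 else 0)
      else 1 + ((t : ℤ) - tM - 2) - (if tM + 1 < τ₃ ∧ τ₃ < t then 1 else 0) := by
    rcases Nat.lt_or_ge t (τ₁ + 1) with h1t | h1t
    · rw [if_pos (by omega), hrun1 t (by omega)]
    rcases Nat.lt_or_ge t (tM + 2) with h2t | h2t
    · have e := hrun2' (t - tm) (by omega)
      rw [show tm + (t - tm) = t by omega, hpk] at e
      rw [if_neg (by omega), if_pos (by omega), e]
      push_cast [Nat.cast_sub (show tm ≤ t by omega)]; ring_nf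
    · have e := hrun3 (t - (tM + 1) - 1) (by omega)
      rw [show tM + 2 + (t - (tM + 1) - 1) = t by omega, hv2] at e
      have hc3 : ((t - (tM + 1) - 1 : ℕ) : ℤ) = (t : ℤ) - tM - 2 := by
        rw [Nat.sub_sub, Nat.cast_sub (show tM + 1 + 1 ≤ t by omega)]; push_cast; ring
      rw [if_neg (by omega), if_neg (by omega), e, hc3]
  clear hrun1 hrun2' hrun3 hpk hv2
  rw [H, subH]
  clear H
  by_cases htσ : t ≤ τ₃
  · rw [if_pos htσ, stapleHN_cast A t]
    rcases hcase with ⟨hc1, hc2, hc3⟩ | ⟨hc1, hc2, hc3, hc4⟩ | ⟨hc1, hc2, hc3⟩ <;> split_ifs <;> omega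
  · rw [if_neg htσ, stapleHN_pred_cast A t (by omega) (by omega)]
    rcases hcase with ⟨hc1, hc2, hc3⟩ | ⟨hc1, hc2, hc3, hc4⟩ | ⟨hc1, hc2, hc3⟩ <;> split_ifs <;> omega

/-- ★★ **One slack.** An irreducible bridge `ω` of `ℤ^{d+1}` with span `A ≥ 2` and length `k = 3A + 1` has the height word `subH A σ`
for a slot `σ` with `1 ≤ σ ≤ 3A`, `σ ≠ A + 1`, `σ ≠ 2A` (the staple word with one letter doubled).
[cite: MadrasSlade1993, §4.2, remark after Theorem 4.2.4 (p. 94)] -/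
theorem heights_of_length_eq_three_mul_span_add_one (d : ℕ) {A k : ℕ} {ω : ℕ → Site (d + 1)}
    (hω : ω ∈ irreducibleBridges (d + 1) k) (hA2 : 2 ≤ A) (hAk : ω k 0 = A) (hk : k = 3 * A + 1) :
    ∃ σ : ℕ, 1 ≤ σ ∧ σ ≤ 3 * A ∧ σ ≠ A + 1 ∧ σ ≠ 2 * A ∧ ∀ t, t ≤ k → ω t 0 = subH A σ t := by
  classical
  obtain ⟨hb, hk1, hbr, hirr⟩ := mem_irreducibleBridges.1 hω
  obtain ⟨hωs, -⟩ := mem_bridges.1 hb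
  obtain ⟨hω0, -, hadj, hinj⟩ := mem_saws.1 hωs
  -- heights
  set h : ℕ → ℤ := fun t => ω t 0 with hh
  have h0 : h 0 = 0 := by simp only [hh, hω0]; rfl
  have hA : h k = A := hAk
  have hstep : ∀ t, t < k → |h (t + 1) - h t| ≤ 1 := fun t ht => abs_sub_le_one_of_adj (hadj t ht) 0
  have hpos : ∀ i, 1 ≤ i → i ≤ k → 0 < h i ∧ h i ≤ h k := fun i hi1 hi2 => by
    have := hbr i hi1 hi2
    rw [hω0] at this
    exact this
  have h1 : h 1 = 1 := by
    have := (hpos 1 le_rfl hk1).1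
    have hs := hstep 0 hk1
    rw [zero_add, abs_le] at hs
    omega
  -- no step pair up-down or down-up (self-avoidance)
  have hmem : ∀ i : ℕ, i ≤ k → i ∈ {j : ℕ | j ≤ k} := fun i hi => hi
  have no_ud : ∀ t, t + 2 ≤ k → h (t + 1) = h t + 1 → h (t + 2) = h (t + 1) - 1 → False := by
    intro t ht hu hd'
    have he : ω (t + 2) = ω t := by
      rw [eq_sub_e0_of_adj d (hadj (t + 1) (by omega)) hd', eq_add_e0_of_adj d (hadj t (by omega)) hu, add_sub_cancel_right]
    have := hinj (hmem (t + 2) ht) (hmem t (by omega)) he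
    omega
  have no_du : ∀ t, t + 2 ≤ k → h (t + 1) = h t - 1 → h (t + 2) = h (t + 1) + 1 → False := by
    intro t ht hd' hu
    have he : ω (t + 2) = ω t := by
      rw [eq_add_e0_of_adj d (hadj (t + 1) (by omega)) hu, eq_sub_e0_of_adj d (hadj t (by omega)) hd', sub_add_cancel]
    have := hinj (hmem (t + 2) ht) (hmem t (by omega)) he
    omega
  -- crossing times of the gap `{g, g+1}`
  set C : ℤ → Finset ℕ := fun g => (range k).filter fun t =>
    (h t = g ∧ h (t + 1) = g + 1) ∨ (h t = g + 1 ∧ h (t + 1) = g) with hC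
  have hmemC : ∀ {g : ℤ} {t : ℕ}, t ∈ C g ↔ t < k ∧ ((h t = g ∧ h (t + 1) = g + 1) ∨ (h t = g + 1 ∧ h (t + 1) = g)) := by
    intro g t
    simp only [hC, Finset.mem_filter, Finset.mem_range]
  have hdisj : ∀ g g' : ℤ, g ≠ g' → Disjoint (C g) (C g') := by
    intro g g' hne
    rw [Finset.disjoint_left]
    intro t ht ht'
    rw [hmemC] at ht ht'
    omega
  have hC0 : 1 ≤ (C 0).card := by
    have : 0 ∈ C 0 := by rw [hmemC]; exact ⟨hk1, Or.inl ⟨h0, by rw [h1]; norm_num⟩⟩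
    exact Finset.card_pos.2 ⟨0, this⟩
  -- an internal gap is crossed up, then down, then up again
  have hcross3 : ∀ g : ℤ, 1 ≤ g → g + 1 ≤ A →
      ∃ t₁ td t₂ : ℕ, t₁ < td ∧ td < t₂ ∧ t₂ < k ∧ h t₁ = g ∧ h (t₁ + 1) = g + 1 ∧ h td = g + 1 ∧ h (td + 1) = g ∧
        h t₂ = g ∧ h (t₂ + 1) = g + 1 := by
    intro g hg1 hgA
    have hex : ∃ s, g + 1 ≤ h s ∧ s ≤ k := ⟨k, by rw [hA]; exact hgA, le_rfl⟩
    obtain ⟨s₀, ⟨hs₀g, hs₀k⟩, hs₀min⟩ : ∃ s, (g + 1 ≤ h s ∧ s ≤ k) ∧ ∀ u, u < s → ¬ (g + 1 ≤ h u ∧ u ≤ k) :=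
      ⟨Nat.find hex, Nat.find_spec hex, fun u hu => Nat.find_min hex hu⟩
    have hs₀0 : s₀ ≠ 0 := by rintro rfl; rw [h0] at hs₀g; omega
    obtain ⟨t₁, rfl⟩ : ∃ t, s₀ = t + 1 := ⟨s₀ - 1, by omega⟩
    have hbelow : ∀ u, u ≤ t₁ → h u ≤ g := by
      intro u hu
      have := hs₀min u (by omega)
      simp only [not_and, not_le] at this
      by_contra hcon
      exact absurd (this (by omega)) (by omega)
    have ht₁g : h t₁ = g := by
      have hs := hstep t₁ (by omega)
      rw [abs_le] at hs
      have := hbelow t₁ le_rfl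
      omega
    have ht₁g1 : h (t₁ + 1) = g + 1 := by
      have hs := hstep t₁ (by omega)
      rw [abs_le] at hs
      omega
    have ht₁1 : 1 ≤ t₁ := by
      by_contra h00
      have : t₁ = 0 := by omega
      rw [this, h0] at ht₁g
      omega
    have ht₁k : t₁ < k := by omega
    have hback : ∃ s, t₁ + 1 ≤ s ∧ s ≤ k ∧ h s ≤ g := by
      by_contra hno
      simp only [not_exists, not_and, not_le] at hno
      refine hirr t₁ ht₁1 (by omega) ⟨ht₁k.le, ?_, ?_⟩
      · intro i hi1 hi2
        refine ⟨(hpos i hi1 (by omega)).1 |> fun h' => by rw [hω0]; exact h', ?_⟩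
        show h i ≤ h t₁
        rw [ht₁g]; exact hbelow i hi2
      · intro j hj1 hj2
        refine ⟨?_, ?_⟩
        · show h (t₁ + 0) < h (t₁ + j)
          rw [add_zero, ht₁g]
          have := hno (t₁ + j) (by omega) (by omega)
          omega
        · show h (t₁ + j) ≤ h (t₁ + (k - t₁))
          rw [show t₁ + (k - t₁) = k by omega]
          exact (hpos (t₁ + j) (by omega) (by omega)).2
    obtain ⟨s, hs1, hsk, hsg⟩ := hback
    obtain ⟨td, htd1, htds, htdg1, htdg⟩ :=
      downcrossSl (g := g) (t₀ := t₁ + 1) (s₁ := s) hstep hs1 hsk (by rw [ht₁g1]) hsg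
    obtain ⟨t₂, ht₂1, ht₂k, ht₂g, ht₂g1⟩ :=
      upcrossSl (g := g) (t₀ := td + 1) (s₁ := k) hstep (show td + 1 ≤ k by omega) le_rfl (by rw [htdg]) (by rw [hA]; exact hgA)
    exact ⟨t₁, td, t₂, by omega, by omega, ht₂k, ht₁g, ht₁g1, htdg1, htdg, ht₂g, ht₂g1⟩
  have hC3 : ∀ g : ℤ, 1 ≤ g → g + 1 ≤ A → 3 ≤ (C g).card := by
    intro g hg1 hgA
    obtain ⟨t₁, td, t₂, h12, h23, ht₂k, ht₁g, ht₁g1, htdg1, htdg, ht₂g, ht₂g1⟩ := hcross3 g hg1 hgA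
    have hsub : ({t₁, td, t₂} : Finset ℕ) ⊆ C g := by
      intro t ht
      simp only [Finset.mem_insert, Finset.mem_singleton] at ht
      rw [hmemC]
      rcases ht with rfl | rfl | rfl
      · exact ⟨by omega, Or.inl ⟨ht₁g, ht₁g1⟩⟩
      · exact ⟨by omega, Or.inr ⟨htdg1, htdg⟩⟩
      · exact ⟨ht₂k, Or.inl ⟨ht₂g, ht₂g1⟩⟩
    have hcard : ({t₁, td, t₂} : Finset ℕ).card = 3 := by
      rw [Finset.card_eq_three]
      exact ⟨t₁, td, t₂, by omega, by omega, by omega, rfl⟩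
    calc 3 = ({t₁, td, t₂} : Finset ℕ).card := hcard.symm
      _ ≤ (C g).card := Finset.card_le_card hsub
  -- the down-steps; the first and the last one are flanked by transverse steps
  set D : Finset ℕ := (range k).filter fun t => h (t + 1) = h t - 1 with hD
  have hmemD : ∀ {t : ℕ}, t ∈ D ↔ t < k ∧ h (t + 1) = h t - 1 := by
    intro t; simp only [hD, Finset.mem_filter, Finset.mem_range]
  obtain ⟨t₁', td', t₂', -, h23', ht₂k', -, -, htdg1', htdg', -, -⟩ := hcross3 1 le_rfl (by exact_mod_cast hA2)
  have htd'D : td' ∈ D := hmemD.2 ⟨by omega, by rw [htdg', htdg1']; ring⟩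
  have hDne : D.Nonempty := ⟨td', htd'D⟩
  set tm := D.min' hDne with htm
  set tM := D.max' hDne with htM
  have htmD : tm ∈ D := Finset.min'_mem D hDne
  have htMD : tM ∈ D := Finset.max'_mem D hDne
  obtain ⟨htmk, htmd⟩ := hmemD.1 htmD
  obtain ⟨htMk, htMd⟩ := hmemD.1 htMD
  have hDmin : ∀ t, t ∈ D → tm ≤ t := fun t ht => by rw [htm]; exact Finset.min'_le D t ht
  have hDmax : ∀ t, t ∈ D → t ≤ tM := fun t ht => by rw [htM]; exact Finset.le_max' D t ht
  have htm1 : 1 ≤ tm := by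
    by_contra h00
    have : tm = 0 := by omega
    rw [this, zero_add, h1, h0] at htmd
    omega
  obtain ⟨τ₁, hτ₁⟩ : ∃ τ, tm = τ + 1 := ⟨tm - 1, by omega⟩
  have hτ₁flat : h (τ₁ + 1) = h τ₁ := by
    have hs := hstep τ₁ (by omega)
    rw [abs_le] at hs
    rcases lt_trichotomy (h (τ₁ + 1)) (h τ₁) with hlt | heq | hgt
    · have := hDmin τ₁ (hmemD.2 ⟨by omega, by omega⟩)
      omega
    · exact heq
    · exact (no_ud τ₁ (by omega) (by omega) (by rw [show τ₁ + 2 = tm + 1 by omega, show τ₁ + 1 = tm by omega]; exact htmd)).elim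
  have hτ₁1 : 1 ≤ τ₁ := by
    by_contra h00
    have : τ₁ = 0 := by omega
    rw [this, zero_add, h1, h0] at hτ₁flat
    omega
  have htMk2 : tM + 2 ≤ k := by
    by_contra hcon
    have : tM + 1 = k := by omega
    have hle : h tM ≤ h k := (hpos tM (by
      by_contra h00
      have h00' : tM = 0 := by omega
      rw [h00', zero_add, h1, h0] at htMd; omega) htMk.le).2
    rw [← this] at hle
    omega
  have hτ₂flat : h (tM + 1 + 1) = h (tM + 1) := by
    have hs := hstep (tM + 1) (by omega)
    rw [abs_le] at hs
    rcases lt_trichotomy (h (tM + 1 + 1)) (h (tM + 1)) with hlt | heq | hgt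
    · have := hDmax (tM + 1) (hmemD.2 ⟨by omega, by omega⟩)
      omega
    · exact heq
    · exact (no_du tM htMk2 htMd (by rw [show tM + 2 = tM + 1 + 1 from rfl]; omega)).elim
  have hτlt : τ₁ < tM + 1 := by
    have := hDmin tM htMD
    omega
  -- COUNT: the crossing times of the gaps `0, …, A−1` are `≥ 3A − 2` of the `3A + 1` times; so at most three flat steps
  set F : Finset ℕ := (range k).filter fun t => h (t + 1) = h t with hF
  have hmemF : ∀ {t : ℕ}, t ∈ F ↔ t < k ∧ h (t + 1) = h t := by
    intro t; simp only [hF, Finset.mem_filter, Finset.mem_range]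
  have hτ₁F : τ₁ ∈ F := hmemF.2 ⟨by omega, hτ₁flat⟩
  have hτ₂F : (tM + 1) ∈ F := hmemF.2 ⟨by omega, hτ₂flat⟩
  set U : Finset ℕ := (range A).biUnion fun i : ℕ => C (i : ℤ) with hU'
  have hU : U ⊆ range k := by
    intro t ht
    obtain ⟨i, -, hi⟩ := Finset.mem_biUnion.1 ht
    rw [hmemC] at hi
    exact Finset.mem_range.2 hi.1
  have hUF : Disjoint U F := by
    rw [hU', Finset.disjoint_biUnion_left]
    intro i _
    rw [Finset.disjoint_left]
    intro t htC htF
    rw [hmemC] at htC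
    rw [hmemF] at htF
    omega
  have hsumU : U.card = ∑ i ∈ range A, (C (i : ℤ)).card := by
    rw [hU', Finset.card_biUnion]
    intro i _ j _ hij
    exact hdisj _ _ (by exact_mod_cast hij)
  have hlow : 3 * A - 2 ≤ U.card := by
    rw [hsumU]
    obtain ⟨M, rfl⟩ : ∃ M, A = M + 1 := ⟨A - 1, by omega⟩
    rw [Finset.sum_range_succ']
    have h3 : 3 * M ≤ ∑ i ∈ range M, (C ((i + 1 : ℕ) : ℤ)).card := by
      calc 3 * M = ∑ i ∈ range M, 3 := by simp [mul_comm]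
        _ ≤ ∑ i ∈ range M, (C ((i + 1 : ℕ) : ℤ)).card :=
            Finset.sum_le_sum fun i hi => by
              have hi' := Finset.mem_range.1 hi
              exact hC3 _ (by push_cast; omega) (by push_cast; omega)
    have h1' : 1 ≤ (C ((0 : ℕ) : ℤ)).card := by simpa using hC0
    omega
  have hFcard : F.card ≤ 3 := by
    have h' : (U ∪ F).card ≤ (range k).card :=
      Finset.card_le_card (Finset.union_subset hU (Finset.filter_subset _ _))
    rw [Finset.card_union_of_disjoint hUF, Finset.card_range] at h'
    omega
  -- the third flat time `τ₃` (or `τ₁` again if there is none): every flat time is one of `τ₁, (tM + 1), τ₃`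
  obtain ⟨τ₃, hτ₃F, hFsub⟩ : ∃ τ₃, τ₃ ∈ F ∧ ∀ t, t ∈ F → t = τ₁ ∨ t = (tM + 1) ∨ t = τ₃ := by
    set G := (F.erase τ₁).erase (tM + 1) with hG
    have hGcard : G.card ≤ 1 := by
      have h1' := Finset.card_erase_of_mem hτ₁F
      have h2' := Finset.card_erase_of_mem (Finset.mem_erase.2 ⟨(by omega : (tM + 1) ≠ τ₁), hτ₂F⟩)
      rw [← hG] at h2'
      omega
    by_cases hGe : G.Nonempty
    · obtain ⟨τ₃, hτ₃⟩ := hGe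
      refine ⟨τ₃, ((Finset.mem_erase.1 (Finset.mem_erase.1 hτ₃).2).2), fun t ht => ?_⟩
      by_cases ht1 : t = τ₁
      · exact Or.inl ht1
      by_cases ht2 : t = (tM + 1)
      · exact Or.inr (Or.inl ht2)
      have htG : t ∈ G := Finset.mem_erase.2 ⟨ht2, Finset.mem_erase.2 ⟨ht1, ht⟩⟩
      exact Or.inr (Or.inr (Finset.card_le_one.1 hGcard t htG τ₃ hτ₃))
    · refine ⟨τ₁, hτ₁F, fun t ht => ?_⟩
      by_cases ht1 : t = τ₁
      · exact Or.inl ht1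
      by_cases ht2 : t = (tM + 1)
      · exact Or.inr (Or.inl ht2)
      exact absurd ⟨t, Finset.mem_erase.2 ⟨ht2, Finset.mem_erase.2 ⟨ht1, ht⟩⟩⟩ hGe
  obtain ⟨hτ₃k, hτ₃flat⟩ := hmemF.1 hτ₃F
  have hvert : ∀ t, t < k → t ≠ τ₁ → t ≠ (tM + 1) → t ≠ τ₃ → h (t + 1) = h t + 1 ∨ h (t + 1) = h t - 1 := by
    intro t htk ht1 ht2 ht3
    have hnF : t ∉ F := fun htF => by rcases hFsub t htF with e | e | e <;> contradiction
    rw [hmemF] at hnF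
    have hs := hstep t htk
    rw [abs_le] at hs
    omega
  have hτ₃0 : 1 ≤ τ₃ := by
    by_contra h00
    have : τ₃ = 0 := by omega
    rw [this, zero_add, h1, h0] at hτ₃flat
    omega
  have hτ₃tm : τ₃ ≠ tm := by rintro rfl; omega
  have hτ₃tM : τ₃ ≠ tM := by rintro rfl; omega
  -- RUN 1: the steps before `τ₁` are up, except the flat one at `τ₃` (if `τ₃ < τ₁`)
  have hrun1 : ∀ t, t ≤ τ₁ → h t = t - if τ₃ < t then 1 else 0 := by
    intro t
    induction t with
    | zero => intro _; rw [h0]; simp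
    | succ t ih =>
      intro ht
      have hprev := ih (by omega)
      by_cases ht3 : t = τ₃
      · subst ht3
        rw [hτ₃flat, hprev, if_neg (lt_irrefl _), if_pos (by omega)]; push_cast; ring
      rcases hvert t (by omega) (by omega) (by omega) ht3 with hup | hdown
      · rw [hup, hprev]
        by_cases h3 : τ₃ < t
        · rw [if_pos h3, if_pos (by omega)]; push_cast; ring
        · rw [if_neg h3, if_neg (by omega)]; push_cast; ring
      · exact absurd (hDmin t (hmemD.2 ⟨by omega, hdown⟩)) (by omega)
  -- RUN 2: the steps `tm, …, tM` are down, except the flat one at `τ₃` (if `tm < τ₃ < tM`) — «next down-step» argument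
  have hrun2 : ∀ n t, t ≤ n → tm ≤ t → t ≤ tM → t ≠ τ₃ → h (t + 1) = h t - 1 := by
    intro n
    induction n with
    | zero =>
      intro t ht htm' _ _
      have : t = 0 := by omega
      subst this
      have : tm = 0 := by omega
      rw [this] at htmd; exact htmd
    | succ n ih =>
      intro t htn htm' htM' ht3
      rcases Nat.lt_or_ge t (n + 1) with hlt | hge
      · exact ih t (by omega) htm' htM' ht3
      have htn' : t = n + 1 := le_antisymm htn hge
      rcases hvert t (by omega) (by omega) (by omega) ht3 with hup | hdown
      swap
      · exact hdown
      exfalso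
      rcases Nat.lt_or_ge tm t with htmt | htmt
      swap
      · have : t = tm := by omega
        rw [this] at hup; omega
      -- `t > tm` is an up-step; the previous step
      by_cases hp3 : t - 1 = τ₃
      · -- flat before: take the next down-step `u > t`; the step before `u` is up: up-down
        set Dt := D.filter fun u => t < u with hDt
        have hDtne : Dt.Nonempty := ⟨tM, Finset.mem_filter.2 ⟨htMD, by
          rcases (show t ≤ tM from htM').lt_or_eq with hl | he
          · exact hl
          · exfalso; rw [he] at hup; omega⟩⟩
        set u := Dt.min' hDtne with hu
        obtain ⟨huD, htu⟩ := Finset.mem_filter.1 (Finset.min'_mem Dt hDtne)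
        obtain ⟨huk, hud⟩ := hmemD.1 huD
        have humin : ∀ u', u' ∈ D → t < u' → u ≤ u' := fun u' hu' htu' => by
          rw [hu]; exact Finset.min'_le Dt u' (Finset.mem_filter.2 ⟨hu', htu'⟩)
        have huM : u ≤ tM := hDmax u huD
        have hprev_up : h u = h (u - 1) + 1 := by
          rcases (show t ≤ u - 1 by omega).lt_or_eq with hl | he
          · have hne3 : u - 1 ≠ τ₃ := by omega
            rcases hvert (u - 1) (by omega) (by omega) (by omega) hne3 with hup' | hdown'
            · rw [show u - 1 + 1 = u by omega] at hup'; exact hup'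
            · have := humin (u - 1) (hmemD.2 ⟨by omega, hdown'⟩) hl
              omega
          · rw [he, show u - 1 + 1 = u by omega] at hup; exact hup
        exact no_ud (u - 1) (by omega) (by rw [show u - 1 + 1 = u by omega]; exact hprev_up)
          (by rw [show u - 1 + 2 = u + 1 by omega, show u - 1 + 1 = u by omega]; exact hud)
      · -- vertical before: by induction it is down: down-up
        have hdown' := ih (t - 1) (by omega) (by omega) (by omega) hp3
        rw [show t - 1 + 1 = t by omega] at hdown'
        exact no_du (t - 1) (by omega) (by rw [show t - 1 + 1 = t by omega]; exact hdown')
          (by rw [show t - 1 + 2 = t + 1 by omega, show t - 1 + 1 = t by omega]; exact hup)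
  have hrun2' : ∀ j, tm + j ≤ tM + 1 → h (tm + j) = h tm - j + if tm < τ₃ ∧ τ₃ < tm + j then 1 else 0 := by
    intro j
    induction j with
    | zero => intro _; rw [if_neg (by omega)]; simp
    | succ j ih =>
      intro hj
      have hprev := ih (by omega)
      rw [show tm + (j + 1) = tm + j + 1 by ring]
      by_cases hj3 : tm + j = τ₃
      · rw [← hj3] at hτ₃flat
        rw [hτ₃flat, hprev, if_neg (by omega), if_pos (by omega)]; push_cast; ring
      rw [hrun2 tM (tm + j) (by omega) (by omega) (by omega) hj3, hprev]
      by_cases h3 : tm < τ₃ ∧ τ₃ < tm + j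
      · rw [if_pos h3, if_pos (by omega)]; push_cast; ring
      · rw [if_neg h3, if_neg (by omega)]; push_cast; ring
  -- RUN 3: the steps after `(tM + 1)` are up, except the flat one at `τ₃` (if `(tM + 1) < τ₃`)
  have hrun3 : ∀ j, tM + 2 + j ≤ k → h (tM + 2 + j) = h (tM + 2) + j - if tM + 1 < τ₃ ∧ τ₃ < tM + 2 + j then 1 else 0 := by
    intro j
    induction j with
    | zero => intro _; rw [if_neg (by omega)]; simp
    | succ j ih =>
      intro hj
      have hprev := ih (by omega)
      rw [show tM + 2 + (j + 1) = tM + 2 + j + 1 by ring]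
      by_cases hj3 : tM + 2 + j = τ₃
      · rw [← hj3] at hτ₃flat
        rw [hτ₃flat, hprev, if_neg (by omega), if_pos (by omega)]; push_cast; ring
      rcases hvert (tM + 2 + j) (by omega) (by omega) (by omega) hj3 with hup | hdown
      · rw [hup, hprev]
        by_cases h3 : (tM + 1) < τ₃ ∧ τ₃ < tM + 2 + j
        · rw [if_pos h3, if_pos (by omega)]; push_cast; ring
        · rw [if_neg h3, if_neg (by omega)]; push_cast; ring
      · exact absurd (hDmax _ (hmemD.2 ⟨by omega, hdown⟩)) (by omega)
  -- the parameters: peak `p = h τ₁ = h tm`, valley `v₀ = h (tM + 1) = h (tM + 2)`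
  have hpk : h tm = h τ₁ := by rw [hτ₁, hτ₁flat]
  have hpeak : h τ₁ = τ₁ - if τ₃ < τ₁ then 1 else 0 := hrun1 τ₁ le_rfl
  have hval : h (tM + 1) = h tm - (tM + 1 - tm : ℕ) + if tm < τ₃ ∧ τ₃ < (tM + 1) then 1 else 0 := by
    have := hrun2' (tM + 1 - tm) (by omega)
    rwa [show tm + (tM + 1 - tm) = (tM + 1) by omega] at this
  have hval' : h (tM + 2) = h (tM + 1) := hτ₂flat
  have hfin : h k = h (tM + 2) + (k - (tM + 1) - 1 : ℕ) - if (tM + 1) < τ₃ ∧ τ₃ < k then 1 else 0 := by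
    have := hrun3 (k - (tM + 1) - 1) (by omega)
    rwa [show tM + 2 + (k - (tM + 1) - 1) = k by omega] at this
  have hp_le : h τ₁ ≤ A := by rw [← hA]; exact (hpos τ₁ (by omega) (by omega)).2
  have hv_ge : 1 ≤ h (tM + 1) := by have := (hpos (tM + 1) (by omega) (by omega)).1; omega
  -- valley `= 1`: the down-crossing of the gap `{1,2}` lands at height `1` inside the descent
  have hv_eq : h (tM + 1) = 1 := by
    have h1' := hDmin td' htd'D
    have h2' := hDmax td' htd'D
    have e := hrun2' (td' + 1 - tm) (by omega)
    rw [show tm + (td' + 1 - tm) = td' + 1 by omega, htdg'] at e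
    rw [hval]
    split_ifs at e ⊢ <;> push_cast [Nat.cast_sub (show tm ≤ td' + 1 by omega), Nat.cast_sub (show tm ≤ tM + 1 by omega)] at e ⊢ <;>
      omega
  -- peak `= A`: otherwise the final ascent passes the peak height at a renewal time
  have hp_eq : h τ₁ = A := by
    by_contra hne
    have hlt : h τ₁ < A := lt_of_le_of_ne hp_le hne
    -- heights up to `tM + 2` are `≤ h τ₁`
    have hb1 : ∀ i, i ≤ tM + 2 → h i ≤ h τ₁ := by
      intro i hi
      rcases Nat.lt_or_ge i (τ₁ + 1) with h1i | h1i
      · rw [hrun1 i (by omega), hpeak]; split_ifs <;> omega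
      rcases Nat.lt_or_ge i (tM + 2) with h2i | h2i
      · have e := hrun2' (i - tm) (by omega)
        rw [show tm + (i - tm) = i by omega, hpk] at e
        rw [e]; split_ifs <;> push_cast [Nat.cast_sub (show tm ≤ i by omega)] <;> omega
      · rw [show i = tM + 2 by omega, hval', hval, hpk]
        split_ifs <;> push_cast [Nat.cast_sub (show tm ≤ tM + 1 by omega)] <;> omega
    -- the last time `ts ≤ k` of height `≤ h τ₁`
    set ts := Nat.findGreatest (fun t => h t ≤ h τ₁) k with hts
    have hts_spec : h ts ≤ h τ₁ := Nat.findGreatest_spec (P := fun t => h t ≤ h τ₁) (m := tM + 2) (by omega) (hb1 _ le_rfl)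
    have hts_ge : tM + 2 ≤ ts := Nat.le_findGreatest (P := fun t => h t ≤ h τ₁) (by omega) (hb1 _ le_rfl)
    have hts_le : ts ≤ k := Nat.findGreatest_le k
    have hts_lt : ts < k := by
      rcases hts_le.lt_or_eq with hl | he
      · exact hl
      · rw [he, hA] at hts_spec; omega
    have hafter : ∀ j, ts < j → j ≤ k → h τ₁ < h j := fun j hj1 hj2 =>
      not_le.1 (Nat.findGreatest_is_greatest (P := fun t => h t ≤ h τ₁) hj1 hj2)
    have hts_eq : h ts = h τ₁ := by
      have hs := hstep ts hts_lt
      rw [abs_le] at hs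
      have := hafter (ts + 1) (by omega) (by omega)
      omega
    -- run 3 is non-decreasing
    have hmono3 : ∀ i j, tM + 2 ≤ i → i ≤ j → j ≤ k → h i ≤ h j := by
      intro i j hi hij hj
      have ei := hrun3 (i - (tM + 1) - 1) (by omega)
      have ej := hrun3 (j - (tM + 1) - 1) (by omega)
      rw [show tM + 2 + (i - (tM + 1) - 1) = i by omega] at ei
      rw [show tM + 2 + (j - (tM + 1) - 1) = j by omega] at ej
      rw [ei, ej]
      split_ifs <;> push_cast [Nat.cast_sub (show tM + 1 ≤ i by omega), Nat.cast_sub (show tM + 1 ≤ j by omega),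
        Nat.cast_sub (show 1 ≤ i - (tM + 1) by omega), Nat.cast_sub (show 1 ≤ j - (tM + 1) by omega)] <;> omega
    refine hirr ts (by omega) (by omega) ⟨hts_le, ?_, ?_⟩
    · intro i hi1 hi2
      refine ⟨(hpos i hi1 (by omega)).1 |> fun h' => by rw [hω0]; exact h', ?_⟩
      show h i ≤ h ts
      rw [hts_eq]
      rcases Nat.lt_or_ge i (tM + 2) with hi' | hi'
      · exact hb1 i hi'.le
      · rw [← hts_eq]; exact hmono3 i ts hi' hi2 hts_le
    · intro j hj1 hj2
      refine ⟨?_, ?_⟩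
      · show h (ts + 0) < h (ts + j)
        rw [add_zero, hts_eq]
        exact hafter (ts + j) (by omega) (by omega)
      · show h (ts + j) ≤ h (ts + (k - ts))
        rw [show ts + (k - ts) = k by omega]
        exact (hpos _ (by omega) (by omega)).2
  -- the ARITHMETIC: `τ₁ = A + x`, `tM + 1 − tm = A − 1 + y`, `k − tM − 2 = A − 1 + z` with `x + y + z = k − 3A = 1`
  have hx : (τ₁ : ℤ) = A + if τ₃ < τ₁ then 1 else 0 := by rw [← hp_eq, hpeak]; ring
  have hy : ((tM + 1 - tm : ℕ) : ℤ) = A - 1 + if tm < τ₃ ∧ τ₃ < tM + 1 then 1 else 0 := by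
    have e := hval; rw [hv_eq, hpk, hp_eq] at e; linarith
  have hz : ((k - (tM + 1) - 1 : ℕ) : ℤ) = A - 1 + if tM + 1 < τ₃ ∧ τ₃ < k then 1 else 0 := by
    have e := hfin; rw [hval', hv_eq, hA] at e; linarith
  obtain ⟨a1, a2, a3, a4, a5⟩ := slack_word (h := h) hA2 hk hτ₁ (hDmin tM htMD) htMk2 hτ₃k hτ₃0 hτ₃tM hx hy hz
    hrun1 hrun2' hrun3 (by rw [hpk, hp_eq]) (by rw [hval', hv_eq])
  exact ⟨τ₃, a1, a2, a3, a4, a5⟩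

end Literature.Probability.RandomPlanarGeometry.SAW.Zd

end
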